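import Literature.Combinatorics.SimpleGraph.PaleySosProofs
import Literature.Combinatorics.SimpleGraph.LovaszThetaComplement
import Literature.Combinatorics.SimpleGraph.LasserreLevelOne
import HarnessLib

/-!
# The Paley graph: vertex-transitivity, `ϑ(P_p) = las⁽¹⁾(P_p) = √p`, self-complementarity, and the
degenerate moduli

Structural facts about `paleyGraph p` (`PaleySos.lean`: `x ∼ y ↔ x ≠ y ∧ (IsSquare (x − y) ∨
IsSquare (y − x))` on `Fin p = ℤ/pℤ`), all PROVED; written for the refuter analysis of the crux
`Summit.PneNP.PneNP.Theses.RamseyUncertifiable.PaleySosRung` (stmt-PneNP-9817) and usable by its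
provers:

* `isVertexTransitive_paleyGraph` (translations), hence with Lovász 1979 Thm 8
  (`lovaszTheta_mul_lovaszTheta_compl_le_card`, tree) and `√p ≤ las⁽¹⁾(P̄_p)` (tree):
  `lovaszTheta_paleyGraph_le_sqrt`, `lasserreStableBound_paleyGraph_le_sqrt` (`las⁽ᵗ⁾(P_p) ≤ √p`,
  all `t ≥ 1`) and `lasserreStableBound_paleyGraph_one : las⁽¹⁾(P_p) = √p` (Kunisky–Yu (17)–(18)).
* `nonempty_iso_compl_paleyGraph : P_p ≃g P̄_p` for primes `p ≡ 1 (mod 4)` (`x ↦ g·x`, `g` a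
  non-residue; Kunisky–Yu Prop. 2.6 / Lovász p. 6). The consequence `las⁽ᵗ⁾(P̄_p) = las⁽ᵗ⁾(P_p)`
  (isomorphism invariance, `LasserreCliqueCover.lean`) is in `PaleyDegenerateModuli.lean`.
* Degenerate moduli of the same `fromRel` formula: for primes `p ≡ 3 (mod 4)` the graph is
  COMPLETE (`paleyGraph_eq_top_of_mod_four_eq_three`); for `p = 3s`, `s ≡ 3 (mod 4)` prime, two
  distinct vertices in the same residue class mod `3` are adjacent (`paleyGraph_adj_of_crt_fst_eq`,
  CRT) — the clique-cover consequence `las⁽ᵗ⁾ ≤ 3` is in `PaleyDegenerateModuli.lean`. Primality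
  and `p ≡ 1 (mod 4)` are both load-bearing in the crux.
* `indepNum_paleyGraph_five_le : α(P_5) ≤ 2` (`P_5 = C_5`, by `decide`).

## References

* [KuniskyYu2022] D. Kunisky, X. Yu, arXiv:2211.02713, Def. 2.3, Prop. 2.6, (17)–(18).
* [Lovasz1979] L. Lovász, IEEE Trans. Inform. Theory 25 (1979), Thm 8 and p. 6 (self-complementary
  vertex-transitive graphs have `ϑ = √n`).
-/

noncomputable section

namespace Literature.Combinatorics.SimpleGraph

open Matrix Finset

/-- Translations are automorphisms: the Paley graph is vertex-transitive. [folklore] -/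
theorem isVertexTransitive_paleyGraph (m : ℕ) : IsVertexTransitive (paleyGraph (m + 1)) := by
  intro u v
  refine ⟨⟨Equiv.addRight (v - u), ?_⟩, ?_⟩
  · intro a b
    simp only [Equiv.coe_addRight, paleyGraph_adj]
    rw [add_sub_add_right_eq_sub, add_sub_add_right_eq_sub, (add_left_injective _).ne_iff]
  · show u + (v - u) = v
    abel

/-- **`ϑ(P_p) ≤ √p`** (Lovász 1979 Thm 8, direction `≤`, for the vertex-transitive `P_p`, combined
with `√p ≤ las⁽¹⁾(P̄_p) ≤ ϑ(P̄_p)` from the tree): the level-`1` value is EXACTLY `√p`.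
[cite: Lovasz1979, Theorem 8] -/
theorem lovaszTheta_paleyGraph_le_sqrt {p : ℕ} (hp : p.Prime) (h4 : p % 4 = 1) :
    lovaszTheta (paleyGraph p) ≤ Real.sqrt p := by
  obtain ⟨m, rfl⟩ : ∃ m, p = m + 1 := ⟨p - 1, (Nat.succ_pred_eq_of_pos hp.pos).symm⟩
  have hprod := lovaszTheta_mul_lovaszTheta_compl_le_card (isVertexTransitive_paleyGraph m)
  rw [Fintype.card_fin] at hprod
  have hc : Real.sqrt ((m + 1 : ℕ) : ℝ) ≤ lovaszTheta (paleyGraph (m + 1))ᶜ :=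
    (sqrt_le_lasserreStableBound_compl_paleyGraph_one hp h4).trans
      (lasserreStableBound_one_le_lovaszTheta _)
  have hs : Real.sqrt ((m + 1 : ℕ) : ℝ) * Real.sqrt ((m + 1 : ℕ) : ℝ) = ((m + 1 : ℕ) : ℝ) :=
    Real.mul_self_sqrt (Nat.cast_nonneg _)
  have hθ0 : 0 ≤ lovaszTheta (paleyGraph (m + 1)) := lovaszTheta_nonneg _
  have hsqrt_pos : 0 < Real.sqrt ((m + 1 : ℕ) : ℝ) :=
    Real.sqrt_pos.2 (by exact_mod_cast Nat.succ_pos m)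
  nlinarith [mul_le_mul_of_nonneg_left hc hθ0]

/-- `las⁽ᵗ⁾(P_p) ≤ √p` for every `t ≥ 1`: no level of the hierarchy beats exponent `1/2` from
below — the exponent `η` of the crux is at most `1/2`. [folklore] -/
theorem lasserreStableBound_paleyGraph_le_sqrt {p : ℕ} (hp : p.Prime) (h4 : p % 4 = 1) {t : ℕ}
    (ht : 1 ≤ t) : lasserreStableBound (paleyGraph p) t ≤ Real.sqrt p :=
  (lasserreStableBound_le_lovaszTheta _ ht).trans (lovaszTheta_paleyGraph_le_sqrt hp h4)

/-- `las⁽¹⁾(P_p) = √p` exactly. [folklore] -/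
theorem lasserreStableBound_paleyGraph_one {p : ℕ} (hp : p.Prime) (h4 : p % 4 = 1) :
    lasserreStableBound (paleyGraph p) 1 = Real.sqrt p :=
  le_antisymm (lasserreStableBound_paleyGraph_le_sqrt hp h4 le_rfl)
    (sqrt_le_lasserreStableBound_paleyGraph_one hp h4)

/-- For a prime `q ≡ 3 (mod 4)`, `−1` is a non-square in `𝔽_q`, so for `d ≠ 0` one of `d`, `−d`
is a square. [folklore] -/
theorem isSquare_or_isSquare_neg_of_mod_four_eq_three (q : ℕ) [Fact q.Prime]
    (h3 : q % 4 = 3) {d : ZMod q} (hd : d ≠ 0) : IsSquare d ∨ IsSquare (-d) := by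
  have hneg : ¬ IsSquare (-1 : ZMod q) := by
    rw [ZMod.exists_sq_eq_neg_one_iff]; omega
  rcases quadraticChar_dichotomy hd with h1 | h1
  · exact Or.inl ((quadraticChar_one_iff_isSquare hd).1 h1)
  · right
    have h2 : quadraticChar (ZMod q) (-d) = 1 := by
      rw [neg_eq_neg_one_mul, map_mul, h1, quadraticChar_neg_one_iff_not_isSquare.2 hneg]
      norm_num
    exact (quadraticChar_one_iff_isSquare (neg_ne_zero.2 hd)).1 h2

/-- For `p ≡ 3 (mod 4)` distinct vertices are ALWAYS adjacent in the symmetrised square-difference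
graph. [folklore] -/
theorem paleyGraph_adj_of_ne_of_mod_four_eq_three (m : ℕ) [Fact (m + 1).Prime]
    (h3 : (m + 1) % 4 = 3) (x y : ZMod (m + 1)) (hne : x ≠ y) : (paleyGraph (m + 1)).Adj x y := by
  rw [paleyGraph_adj]
  refine ⟨hne, ?_⟩
  change IsSquare (x - y) ∨ IsSquare (y - x)
  rw [← neg_sub x y]
  exact isSquare_or_isSquare_neg_of_mod_four_eq_three (m + 1) h3 (sub_ne_zero.2 hne)

/-- For `p ≡ 3 (mod 4)` the symmetrised square-difference graph is COMPLETE. [folklore] -/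
theorem paleyGraph_eq_top_of_mod_four_eq_three (m : ℕ) [Fact (m + 1).Prime]
    (h3 : (m + 1) % 4 = 3) : paleyGraph (m + 1) = ⊤ := by
  ext x y
  rw [SimpleGraph.top_adj]
  exact ⟨fun h => h.ne, fun hne => paleyGraph_adj_of_ne_of_mod_four_eq_three m h3 x y hne⟩

/-- `α(P_5) ≤ 2` (`P_5 = C_5`). [folklore] -/
theorem indepNum_paleyGraph_five_le : (paleyGraph 5).indepNum ≤ 2 := by
  obtain ⟨s, hs⟩ := (paleyGraph 5).exists_isNIndepSet_indepNum
  rw [← hs.card_eq]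
  by_contra h
  have key : ∀ s : Finset (Fin 5), 3 ≤ s.card →
      ∃ u ∈ s, ∃ v ∈ s, u ≠ v ∧ (paleyGraph 5).Adj u v := by
    simp only [paleyGraph_adj]
    decide
  obtain ⟨u, hu, v, hv, huv, hadj⟩ := key s (by omega)
  exact hs.isIndepSet (mem_coe.2 hu) (mem_coe.2 hv) huv hadj

/-! #### Composite moduli `p = 3s`: the residue classes mod `3` are cliques -/

/-- For `p = 3s` (`s` prime, `s ≡ 3 (mod 4)`, `3 ∤ s`): two distinct elements of `ℤ/pℤ` with the
same CRT coordinate mod `3` differ by `d ↔ (0, c)`, `c ≠ 0`, and `c` or `−c` is a square in `𝔽_s`,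
so `d` or `−d` is a square in `ℤ/pℤ`: the vertices are ADJACENT. [folklore] -/
theorem paleyGraph_adj_of_crt_fst_eq {m s : ℕ} [Fact s.Prime] (hs3 : s % 4 = 3)
    (hcop : Nat.Coprime 3 s) (hm : m + 1 = 3 * s) (x y : ZMod (m + 1)) (hne : x ≠ y)
    (hxy : ((ZMod.ringEquivCongr hm).trans (ZMod.chineseRemainder hcop) x).1 =
      ((ZMod.ringEquivCongr hm).trans (ZMod.chineseRemainder hcop) y).1) :
    (paleyGraph (m + 1)).Adj x y := by
  set e := (ZMod.ringEquivCongr hm).trans (ZMod.chineseRemainder hcop) with he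
  rw [paleyGraph_adj]
  refine ⟨hne, ?_⟩
  change IsSquare (x - y) ∨ IsSquare (y - x)
  have hc : (e x).2 - (e y).2 ≠ 0 := by
    intro h0
    exact hne (e.injective (Prod.ext hxy (sub_eq_zero.1 h0)))
  have key : ∀ {a b : ZMod (m + 1)}, (e a).1 = (e b).1 → IsSquare ((e a).2 - (e b).2) →
      IsSquare (a - b) := by
    intro a b hab hsq
    obtain ⟨w, hw⟩ := hsq
    have h1 : e (a - b) = (0, w) * (0, w) := by
      rw [map_sub, Prod.ext_iff]
      refine ⟨?_, ?_⟩
      · simp [hab]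
      · simpa using hw
    have h2 : a - b = e.symm (0, w) * e.symm (0, w) := by
      rw [← map_mul, ← h1, RingEquiv.symm_apply_apply]
    exact ⟨_, h2⟩
  rcases isSquare_or_isSquare_neg_of_mod_four_eq_three s hs3 hc with h | h
  · exact Or.inl (key hxy h)
  · right
    rw [neg_sub] at h
    exact key hxy.symm h

/-! ### Self-complementarity -/

/-- **Self-complementarity of the Paley graph** (`x ↦ g x`, `g` a non-residue, maps edges to
non-edges: `χ(g(x − y)) = −χ(x − y)`). [cite: KuniskyYu2022, Proposition 2.6] -/
theorem nonempty_iso_compl_paleyGraph (n : ℕ) [Fact (n + 1).Prime] (h4 : (n + 1) % 4 = 1) :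
    Nonempty (paleyGraph (n + 1) ≃g (paleyGraph (n + 1))ᶜ) := by
  obtain ⟨g, hg⟩ := quadraticChar_exists_neg_one (ringChar_zmod_ne_two h4)
  have hg0 : g ≠ 0 := by
    rintro rfl
    simp at hg
  have key : ∀ x y : ZMod (n + 1),
      (paleyGraph (n + 1))ᶜ.Adj (g * x) (g * y) ↔ (paleyGraph (n + 1)).Adj x y := by
    intro x y
    change (g * x ≠ g * y ∧ ¬ (paleyGraph (n + 1)).Adj (g * x) (g * y)) ↔
      (paleyGraph (n + 1)).Adj x y
    have hinj : g * x ≠ g * y ↔ x ≠ y := (mul_right_injective₀ hg0).ne_iff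
    have hmul : quadraticChar (ZMod (n + 1)) (g * x - g * y) =
        -quadraticChar (ZMod (n + 1)) (x - y) := by
      rw [← mul_sub, map_mul, hg, neg_one_mul]
    rw [paleyGraph_adj_iff_quadraticChar n h4, paleyGraph_adj_iff_quadraticChar n h4, hinj, hmul]
    constructor
    · rintro ⟨hne, h⟩
      refine ⟨hne, ?_⟩
      have hd : x - y ≠ 0 := sub_ne_zero.2 hne
      rcases quadraticChar_dichotomy hd with h1 | h1
      · exact h1
      · exact absurd ⟨hne, by rw [h1]; norm_num⟩ h
    · rintro ⟨hne, h⟩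
      refine ⟨hne, fun h' => ?_⟩
      have h'' := h'.2
      rw [h] at h''
      norm_num at h''
  exact ⟨⟨(Equiv.mulLeft₀ g hg0 :), fun {a b} => key a b⟩⟩


end Literature.Combinatorics.SimpleGraph

end
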